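/-
Copyright (c) 2026 the pub-hodgecm-mathlib formalisation cell (harness21).  Prover seat hodgecm-mathlib-LH4-p16 (g2), req620 Track A «(D-RAM) FOUR-FRAME» squad
(STAGE-1b, row (2) of the piece `f_{T₊}`, the (β₂) road (R-36); β₂ sub-dealer LH4-p04 (g9) WORD 23:52:38Z «= ROAD K5∕K6», target ‹CORE.letter.v1›; MECH-K3 v1 §1:
K5-C, fifth file), 2026-09-05.
-/
import Summits.HodgeConjecture.HodgeConjecture.Theorems.F0P3cDyRamRowCellDigitTransport   -- ★ K5-C (4) (this seat): the multiplier algebra; brings ★ p863246 (flip keeps the cell), ★ `dualGen_mul_left`, ★ DEFS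
import HarnessLib

/-!
# Crux `H413`, line LH4 «(D-RAM) FOUR-FRAME» — STAGE-1b, row (2), the (β₂) road (R-36), (ROW-INT) ∕ ‹CORE›, K5-C (5): «FIBRES OVER TWO DIGITS OF ONE CLASS ARE EQUINUMEROUS» —
# the lattice-level transport `Λ ↦ ε • Λ`, `εΘε = ρκ₂∕ρκ₁`, between the fibres of a depth-refined row cell over two points `κ₁, κ₂` of the digit line

Cell `hodgecm-mathlib` (D-0151), FLOOR 0, crux item H413 = `stmt-HodgeConjecture-24833`, route of record `HCCMUnconditional`; squad F0∕P3c∕LH4; lane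
`--supports stmt-HodgeConjecture-24833 --as helper` (count-neutral; pays NO tier-0 row).  THEOREMS ONLY (no `def`, no instance, no notation, no `sorry`, default heartbeats);
★-only imports; states NO law; (β₂) stays a HYPOTHESIS.  DATUM-FREE one-field letters (`K` with commuting involutive isometries `ρ`, `Θ`; `α`, `h`, a `ρ`-fixed `ϖE`; ★ DEFS
`IsOrd ∕ dualGen ∕ levelSet`); two LETTERS as binders: `hFgap` («no doubly-fixed valuation strictly between `|ϖE|` and `1`» — `F`-valuations are even powers, frame `_c19`) and
`hdeep` («doubly-fixed units `≡ 1` to depth `r₀` are `Θ`-norms of `ρ`-fixed elements» — `E`-side ★ `normSign_eq_one_of_fixed_of_v_sub_one_le`, LH4-p19's letter verbatim in shape).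
WHY (MECH-K3 v1 §1–§2 `F0/P3c/LH4/LH4-p16/g2/MECH-K3.v1.LH4p16g2.md`; sub-dealer «= ROAD K5∕K6»).  A vertex `Λ = x₀𝒪_j` of the live row carries `u₀ := h·x₀Θx₀`, its POPULATION scalar
`t := Tr_ρ u₀` (a doubly fixed unit; the glue unit is `∝ t`) and its DIGIT `κ̂ := ρu₀∕t` on the line `{Tr_ρ = 1}`; `X_lit(cell) = Σ_Λ weight·label` with `weight = [class of t]`,
`label = ω(t′)·ω(α₁ + γ₁V(κ̂))` (★ p863048 ∕ p862871 ∕ p862927).  To turn this into a character sum over digits one needs: the FIBRE of the cell over (class `P`, digit ball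
`|κ̂ − κ₁| ≤ r`) has the same size as the fibre over (`P`, `|κ̂ − κ₂| ≤ r`) whenever `κ₁, κ₂` lie on the same sphere of the line (`|κ₂ − κ₁| < |κ₁| = R`, `R·|ϖE^j(α − ρα)| = |ϖE|^a`)
and `ρκ₂∕ρκ₁` is a `Θ`-norm `εΘε` (⟺ same `Q`-class, ★ p863223).  THIS FILE proves it: `Λ ↦ ε • Λ` maps the first fibre injectively into the second (HEAD
`ncard_fibre_le_ncard_fibre`) — the cell clauses by ★ p863246 under the skew letter `|N − ρN|·|Y| < |Y − ρY|`, which ★ K5-C (4) `transportMul_sub_map_eq` turns into `|κ₂ − κ₁| < |κ₁|`;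
the digit by ★ K5-C (4) `v_newPoint_sub_le` (`|κ̂′ − κ₂| ≤ |κ̂ − κ₁|`); the class by `t′ = t(1 + τ)` with `τ` doubly fixed, `|τ| ≤ |κ₂ − κ₁|·r∕R² ≤ r₀` and `hdeep` — and, applied to
`ε⁻¹`, the EQUALITY `ncard_fibre_eq_ncard_fibre`.  (Lane-B prototype: LH4-p19 (g2) ★ `…DiagonalCellFibreTransport`, diagonal cell, `|α − ρα| = 1`; here ANY cell `(j, a)`, `|α − ρα|` free.)
WHAT IS NOT CLAIMED: which digits occur («shell = cell index», K5-C (6)), the `t`-halves (K5-C (7)), any census identity.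
HONEST LABEL.  Count-neutral lattice bookkeeping; nothing printed is asserted; no census law is stated; `HC_CM` is proved only modulo the 7 printed citations (2 remaining named inputs:
hLiu418 = `stmt-HodgeConjecture-24832`, h413 = `stmt-HodgeConjecture-24833`) until rung 0 closes.
## References
* [Jacobowitz1962] R. Jacobowitz, *Hermitian forms over local fields*, Amer. J. Math. 84 (1962): §4 (dual lattices, gluing).
* [Kottwitz1986BaseChangeUnits] R. E. Kottwitz, *Base change for unit elements of Hecke algebras*, Compositio Math. 60 (1986): §1 pp. 240–241 (fixed-lattice counts as orbital integrals).
* [Flicker1998UnitaryFL] Y. Z. Flicker, *Elementary proof of the fundamental lemma for a unitary group*, Canad. J. Math. 50 (1998): Prop. 7 p. 84 (torus-orbit census).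
* [Serre1979] J.-P. Serre, *Local Fields*, GTM 67 (1979): Ch. III §6 Prop. 12, Ch. V §3 Cor. 3.
-/

set_option autoImplicit false

noncomputable section

namespace Summit.HodgeConjecture.HodgeConjecture.Cruxes.H413.F0P3cDyRamRowCellFibreTransport

open scoped Valued WithZero Pointwise
open WithZero
open Summit.HodgeConjecture.HodgeConjecture.Cruxes.H413.F0P3cDyRamToricCensusDefs
open Summit.HodgeConjecture.HodgeConjecture.Cruxes.H413.F0P3cDyRamConeCellLabelBalance (dualGen_mul_left)
open Summit.HodgeConjecture.HodgeConjecture.Cruxes.H413.F0P3cDyRamRowCellFlipTransport (isOrd_mul_iff_of_skew isOrd_mul_div_iff_of_skew isOrd_div_mul_of_skew)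
open Summit.HodgeConjecture.HodgeConjecture.Cruxes.H413.F0P3cDyRamRowCellDigitTransport

variable {K : Type} [Field K] [Valued K ℤᵐ⁰] {ρ Θ : K →+* K} {α : K}

/-! ## §1 The population scalar of a Gram-primitive vertex is a doubly-fixed unit -/

omit [Valued K ℤᵐ⁰] in
/-- **`Y − ρY = t·cc(α − ρα)`** for `Y = dualGen = u₀·cc(α − ρα)`, `u₀ = h·x₀Θx₀`, `t = Tr_ρ u₀` (`ρcc = cc`, `ρ² = 1`). [cite: Jacobowitz1962, §4] -/
theorem dualGen_sub_map_eq (hρρ : ∀ x, ρ (ρ x) = x) {cc h x₀ : K} (hρcc : ρ cc = cc) :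
    dualGen ρ Θ α cc h x₀ - ρ (dualGen ρ Θ α cc h x₀) = (h * (x₀ * Θ x₀) + ρ (h * (x₀ * Θ x₀))) * (cc * (α - ρ α)) := by
  rw [dualGen_def, map_mul (ρ) (h * (x₀ * Θ x₀)), map_mul ρ cc, map_sub, hρcc, hρρ]; ring

/-- **THE POPULATION SCALAR IS A DOUBLY-FIXED UNIT.**  For a vertex of the cell (`Y ∈ 𝒪_cc`, Gram-primitive, level `a ≥ 1`, `|ϖE| ≤ 1`, `cc = ϖE^j`, `ρϖE = ϖE`, `cc(α − ρα) ≠ 0`,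
`Θh = h`) and the letter `hFgap`: `ρt = t`, `Θt = t`, `|t| = 1`. [cite: Jacobowitz1962, §4] [cite: Serre1979, Ch. III §6 Prop. 12] -/
theorem trace_letters (hρρ : ∀ x, ρ (ρ x) = x) (hΘΘ : ∀ x, Θ (Θ x) = x) (hΘρ : ∀ x, Θ (ρ x) = ρ (Θ x))
    {h ϖE x₀ : K} (hΘh : Θ h = h) (hρϖ : ρ ϖE = ϖE) (hϖ0 : ϖE ≠ 0) (hϖ1 : Valued.v ϖE ≤ 1) {j a : ℕ} (ha1 : 1 ≤ a) (hcc : ϖE ^ j * (α - ρ α) ≠ 0)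
    (hFgap : ∀ z : K, ρ z = z → Θ z = z → Valued.v ϖE < Valued.v z → Valued.v z ≤ 1 → Valued.v z = 1)
    (hyO : IsOrd ρ α (ϖE ^ j) (dualGen ρ Θ α (ϖE ^ j) h x₀)) (hyprim : ¬ IsOrd ρ α (ϖE ^ j) (dualGen ρ Θ α (ϖE ^ j) h x₀ / ϖE))
    (hylev : Valued.v (dualGen ρ Θ α (ϖE ^ j) h x₀) = Valued.v ϖE ^ a) :
    ρ (h * (x₀ * Θ x₀) + ρ (h * (x₀ * Θ x₀))) = h * (x₀ * Θ x₀) + ρ (h * (x₀ * Θ x₀)) ∧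
      Θ (h * (x₀ * Θ x₀) + ρ (h * (x₀ * Θ x₀))) = h * (x₀ * Θ x₀) + ρ (h * (x₀ * Θ x₀)) ∧
      Valued.v (h * (x₀ * Θ x₀) + ρ (h * (x₀ * Θ x₀))) = 1 := by
  set t : K := h * (x₀ * Θ x₀) + ρ (h * (x₀ * Θ x₀)) with htdef
  have hρt : ρ t = t := by rw [htdef, map_add, hρρ, add_comm]
  have hΘu : Θ (h * (x₀ * Θ x₀)) = h * (x₀ * Θ x₀) := by rw [map_mul, map_mul, hΘh, hΘΘ]; ring
  have hΘt : Θ t = t := by rw [htdef, map_add, hΘρ, hΘu]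
  refine ⟨hρt, hΘt, ?_⟩
  have hρcc : ρ (ϖE ^ j) = ϖE ^ j := by rw [map_pow, hρϖ]
  have hsub := dualGen_sub_map_eq (Θ := Θ) (α := α) hρρ (h := h) (x₀ := x₀) hρcc
  have hpos : (0 : ℤᵐ⁰) < Valued.v (ϖE ^ j * (α - ρ α)) := zero_lt_iff.2 ((Valuation.ne_zero_iff _).2 hcc)
  -- `|t| ≤ 1` from integrality
  have hle : Valued.v t ≤ 1 := by
    have h1 := hyO.2; rw [hsub, Valuation.map_mul] at h1
    exact le_of_mul_le_mul_right (by rwa [one_mul]) hpos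
  -- `|t| > |ϖE|` from Gram-primitivity
  have hgt : Valued.v ϖE < Valued.v t := by
    by_contra hnot
    replace hnot : Valued.v t ≤ Valued.v ϖE := not_lt.1 hnot
    apply hyprim
    refine ⟨?_, ?_⟩
    · rw [map_div₀, hylev, div_le_one₀ (zero_lt_iff.2 ((Valuation.ne_zero_iff _).2 hϖ0))]
      calc Valued.v ϖE ^ a ≤ Valued.v ϖE ^ 1 := pow_le_pow_right_of_le_one' hϖ1 ha1
        _ = Valued.v ϖE := pow_one _
    · have e : dualGen ρ Θ α (ϖE ^ j) h x₀ / ϖE - ρ (dualGen ρ Θ α (ϖE ^ j) h x₀ / ϖE) = t * (ϖE ^ j * (α - ρ α)) / ϖE := by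
        rw [map_div₀, hρϖ, ← sub_div, hsub]
      rw [e, map_div₀, Valuation.map_mul, div_le_iff₀ (zero_lt_iff.2 ((Valuation.ne_zero_iff _).2 hϖ0)), mul_comm (Valued.v (ϖE ^ j * (α - ρ α)))]
      exact mul_le_mul' hnot le_rfl
  exact hFgap t hρt hΘt hgt hle

/-! ## §2 HEAD — the fibre over `κ₁` injects into the fibre over `κ₂` -/

/-- **HEAD — «FIBRES OVER TWO DIGITS OF ONE CLASS ARE EQUINUMEROUS» (injection half).**  Cell `(j, a)` of the live row (`1 ≤ a`), depth multiplier `μ` with the row size letter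
`|μ| ≤ (|ϖE|^a)²`; two points `κ₁, κ₂` of the line `{Tr_ρ κ = 1}`, `Θ`-fixed, on the cell's sphere (`|κ₁|·|ϖE^j(α − ρα)| = |ϖE|^a`) with `|κ₂ − κ₁| < |κ₁|`; a tolerance `r < |κ₁|` with
`|κ₂ − κ₁|·r ≤ r₀·|κ₁|²`; a flip `ε` with `εΘε = ρκ₂∕ρκ₁`; the letters `hFgap`, `hdeep`.  FIBRE over `(P, κᵢ)` := lattices `Λ` with a generator `x₀` satisfying the five `levelSet`
clauses and the depth clause, whose population scalar `t = Tr_ρ(h x₀Θx₀)` is a `Θ`-norm of a `ρ`-fixed element iff `P`, and whose digit `κ̂ = ρ(h x₀Θx₀)∕t` has `|κ̂ − κᵢ| ≤ r`.  THEN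
`#fibre(P, κ₁) ≤ #fibre(P, κ₂)`. [cite: Kottwitz1986BaseChangeUnits, §1 pp. 240–241] [cite: Flicker1998UnitaryFL, Prop. 7 p. 84] [cite: Jacobowitz1962, §4] [cite: Serre1979, Ch. V §3 Cor. 3] -/
theorem ncard_fibre_le_ncard_fibre (hρρ : ∀ x, ρ (ρ x) = x) (hvρ : ∀ x, Valued.v (ρ x) = Valued.v x) (hΘΘ : ∀ x, Θ (Θ x) = x)
    (hΘρ : ∀ x, Θ (ρ x) = ρ (Θ x))
    {h ϖE μ : K} (hΘh : Θ h = h) (hρϖ : ρ ϖE = ϖE) (hϖ0 : ϖE ≠ 0) (hϖ1 : Valued.v ϖE ≤ 1) {j a : ℕ} (ha1 : 1 ≤ a)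
    (hcc : ϖE ^ j * (α - ρ α) ≠ 0)
    (hμ : Valued.v μ ≤ (Valued.v ϖE ^ a) ^ 2)
    (hFgap : ∀ z : K, ρ z = z → Θ z = z → Valued.v ϖE < Valued.v z → Valued.v z ≤ 1 → Valued.v z = 1)
    {r₀ : ℤᵐ⁰} (hdeep : ∀ u : K, ρ u = u → Θ u = u → Valued.v (u - 1) ≤ r₀ → ∃ c : K, ρ c = c ∧ c * Θ c = u)
    {κ₁ κ₂ : K} (hκ₁ : κ₁ + ρ κ₁ = 1) (hκ₂ : κ₂ + ρ κ₂ = 1) (hΘκ₁ : Θ κ₁ = κ₁) (hΘκ₂ : Θ κ₂ = κ₂)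
    (hR : Valued.v κ₁ * Valued.v (ϖE ^ j * (α - ρ α)) = Valued.v ϖE ^ a) (h12 : Valued.v (κ₂ - κ₁) < Valued.v κ₁)
    {r : ℤᵐ⁰} (hr : r < Valued.v κ₁) (hrτ : Valued.v (κ₂ - κ₁) * r ≤ r₀ * Valued.v κ₁ ^ 2)
    {ε : K} (hε : ε * Θ ε = ρ κ₂ / ρ κ₁) (P : Prop) (hfin : (levelSet ρ Θ α ϖE h j a).Finite) :
    {Λ : AddSubgroup K | ∃ x₀ : K, x₀ ≠ 0 ∧ (∀ x, x ∈ Λ ↔ ∃ ζ, IsOrd ρ α (ϖE ^ j) ζ ∧ x = x₀ * ζ) ∧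
        IsOrd ρ α (ϖE ^ j) (dualGen ρ Θ α (ϖE ^ j) h x₀) ∧ ¬ IsOrd ρ α (ϖE ^ j) (dualGen ρ Θ α (ϖE ^ j) h x₀ / ϖE) ∧
        Valued.v (dualGen ρ Θ α (ϖE ^ j) h x₀) = Valued.v ϖE ^ a ∧ IsOrd ρ α (ϖE ^ j) (μ / dualGen ρ Θ α (ϖE ^ j) h x₀) ∧
        ((∃ c : K, ρ c = c ∧ c * Θ c = h * (x₀ * Θ x₀) + ρ (h * (x₀ * Θ x₀))) ↔ P) ∧
        Valued.v (ρ (h * (x₀ * Θ x₀)) / (h * (x₀ * Θ x₀) + ρ (h * (x₀ * Θ x₀))) - κ₁) ≤ r}.ncard ≤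
      {Λ : AddSubgroup K | ∃ x₀ : K, x₀ ≠ 0 ∧ (∀ x, x ∈ Λ ↔ ∃ ζ, IsOrd ρ α (ϖE ^ j) ζ ∧ x = x₀ * ζ) ∧
        IsOrd ρ α (ϖE ^ j) (dualGen ρ Θ α (ϖE ^ j) h x₀) ∧ ¬ IsOrd ρ α (ϖE ^ j) (dualGen ρ Θ α (ϖE ^ j) h x₀ / ϖE) ∧
        Valued.v (dualGen ρ Θ α (ϖE ^ j) h x₀) = Valued.v ϖE ^ a ∧ IsOrd ρ α (ϖE ^ j) (μ / dualGen ρ Θ α (ϖE ^ j) h x₀) ∧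
        ((∃ c : K, ρ c = c ∧ c * Θ c = h * (x₀ * Θ x₀) + ρ (h * (x₀ * Θ x₀))) ↔ P) ∧
        Valued.v (ρ (h * (x₀ * Θ x₀)) / (h * (x₀ * Θ x₀) + ρ (h * (x₀ * Θ x₀))) - κ₂) ≤ r}.ncard := by
  classical
  -- letters
  have hvϖ0 : Valued.v ϖE ≠ 0 := (Valuation.ne_zero_iff _).2 hϖ0
  have hvκ₁ : Valued.v κ₁ ≠ 0 := fun h0 => by rw [h0, zero_mul] at hR; exact pow_ne_zero _ hvϖ0 hR.symm
  have hpos₁ : (0 : ℤᵐ⁰) < Valued.v κ₁ := zero_lt_iff.2 hvκ₁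
  have hκ₁0 : κ₁ ≠ 0 := (Valuation.ne_zero_iff _).1 hvκ₁
  have hccpos : (0 : ℤᵐ⁰) < Valued.v (ϖE ^ j * (α - ρ α)) := zero_lt_iff.2 ((Valuation.ne_zero_iff _).2 hcc)
  have hρcc : ρ (ϖE ^ j) = ϖE ^ j := by rw [map_pow, hρϖ]
  -- the multiplier `N = ρκ₂∕ρκ₁ = εΘε`: a unit with skew `|κ₂ − κ₁|∕|κ₁|²`
  have hN1 : Valued.v (ε * Θ ε) = 1 := by rw [hε]; exact v_transportMul_eq_one hvρ hκ₁0 h12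
  have hNsk : Valued.v (ε * Θ ε - ρ (ε * Θ ε)) = Valued.v (κ₂ - κ₁) / Valued.v κ₁ ^ 2 := by
    rw [hε]; exact v_transportMul_sub_map_eq hρρ hvρ hκ₁ hκ₂ hκ₁0
  have hε0 : ε ≠ 0 := fun h0 => by rw [h0, zero_mul, map_zero] at hN1; exact zero_ne_one hN1
  -- the map `Λ ↦ ε • Λ`, injective, into a finite set
  refine Set.ncard_le_ncard_of_injOn (fun Λ => ε • Λ) (fun Λ hΛ => ?_) (fun Λ₁ _ Λ₂ _ h12' => by
      have := congrArg (fun Λ => ε⁻¹ • Λ) h12'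
      simpa only [smul_smul, inv_mul_cancel₀ hε0, one_smul] using this)
    (hfin.subset fun Λ ⟨x₀, hx₀, hmem, hyO, hyprim, hylev, _, _, _⟩ => ⟨x₀, hx₀, hmem, hyO, hyprim, hylev⟩)
  obtain ⟨x₀, hx₀, hmem, hyO, hyprim, hylev, hdep, hcls, hdig⟩ := hΛ
  -- the old vertex: `u₀`, `t`, `κ̂`
  obtain ⟨hρt, hΘt, ht1⟩ := trace_letters (α := α) hρρ hΘΘ hΘρ hΘh hρϖ hϖ0 hϖ1 ha1 hcc hFgap hyO hyprim hylev
  set u₀ : K := h * (x₀ * Θ x₀) with hu₀def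
  set t : K := u₀ + ρ u₀ with htdef
  set κ : K := ρ u₀ / t with hκdef
  have ht0 : t ≠ 0 := fun h0 => by rw [h0, map_zero] at ht1; exact zero_ne_one ht1
  have hΘu : Θ u₀ = u₀ := by rw [hu₀def, map_mul, map_mul, hΘh, hΘΘ]; ring
  have hY : dualGen ρ Θ α (ϖE ^ j) h x₀ = u₀ * (ϖE ^ j * (α - ρ α)) := by rw [dualGen_def]
  have hu₀v : Valued.v u₀ = Valued.v κ₁ := by
    have h1 := hylev; rw [hY, Valuation.map_mul, ← hR] at h1
    exact mul_right_cancel₀ ((Valuation.ne_zero_iff _).2 hcc) h1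
  have hκtr : κ + ρ κ = 1 := by rw [hκdef, map_div₀, hρρ, hρt, ← add_div, htdef, add_comm, div_self ht0]
  have hΘκ : Θ κ = κ := by rw [hκdef, map_div₀, hΘρ, hΘu, hΘt]
  have hκv : Valued.v κ = Valued.v κ₁ := by rw [hκdef, map_div₀, hvρ, hu₀v, ht1, div_one]
  have hκκ : Valued.v (κ - κ₁) < Valued.v κ₁ := lt_of_le_of_lt hdig hr
  have hu₀eq : u₀ = t * ρ κ := eq_trace_mul_map_point hρρ ht0
  -- the skew letter of ★ p863246
  have hYsk : Valued.v (dualGen ρ Θ α (ϖE ^ j) h x₀ - ρ (dualGen ρ Θ α (ϖE ^ j) h x₀)) = Valued.v (ϖE ^ j * (α - ρ α)) := by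
    rw [dualGen_sub_map_eq (Θ := Θ) (α := α) hρρ hρcc, Valuation.map_mul, ht1, one_mul]
  have hsk : Valued.v (ε * Θ ε - ρ (ε * Θ ε)) * Valued.v (dualGen ρ Θ α (ϖE ^ j) h x₀) <
      Valued.v (dualGen ρ Θ α (ϖE ^ j) h x₀ - ρ (dualGen ρ Θ α (ϖE ^ j) h x₀)) := by
    rw [hNsk, hYsk, hY, Valuation.map_mul, hu₀v, pow_two, div_mul_eq_mul_div,
      show Valued.v (κ₂ - κ₁) * (Valued.v κ₁ * Valued.v (ϖE ^ j * (α - ρ α))) = Valued.v (κ₂ - κ₁) * Valued.v (ϖE ^ j * (α - ρ α)) * Valued.v κ₁ by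
        rw [mul_comm (Valued.v κ₁), mul_assoc],
      mul_div_mul_right _ _ hvκ₁, div_lt_iff₀ hpos₁, mul_comm (Valued.v (ϖE ^ j * (α - ρ α))) (Valued.v κ₁)]
    exact mul_lt_mul_of_pos_right h12 hccpos
  -- the new vertex over `ε·x₀`
  have hdg : dualGen ρ Θ α (ϖE ^ j) h (ε * x₀) = (ε * Θ ε) * dualGen ρ Θ α (ϖE ^ j) h x₀ := dualGen_mul_left _ _ _ _
  have hu' : h * (ε * x₀ * Θ (ε * x₀)) = ρ κ₂ / ρ κ₁ * (t * ρ κ) := by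
    rw [← hε, ← hu₀eq, hu₀def, map_mul]; ring
  obtain ⟨hτlt, hTr1, hnew⟩ := v_newPoint_sub_le hvρ hκ₁ hκ₂ hκtr hκ₁0 h12 hκκ
  have hρκ₁0 : ρ κ₁ ≠ 0 := (map_ne_zero ρ).2 hκ₁0
  have hTr : κ₂ * κ / κ₁ + ρ (κ₂ * κ / κ₁) = 1 + (κ₂ - κ₁) * (κ - κ₁) / (κ₁ * ρ κ₁) := trace_transport_eq hκ₁ hκ₂ hκtr hκ₁0 hρκ₁0
  set τ : K := (κ₂ - κ₁) * (κ - κ₁) / (κ₁ * ρ κ₁) with hτdef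
  have hTr0 : κ₂ * κ / κ₁ + ρ (κ₂ * κ / κ₁) ≠ 0 := fun h0 => by rw [h0, map_zero] at hTr1; exact zero_ne_one hTr1
  -- its population scalar `t′ = t·(1 + τ)` and digit `κ̂′`
  have ht' : h * (ε * x₀ * Θ (ε * x₀)) + ρ (h * (ε * x₀ * Θ (ε * x₀))) = t * (1 + τ) := by rw [hu', newTrace_eq hρρ hρt, hTr]
  have hκ' : ρ (h * (ε * x₀ * Θ (ε * x₀))) / (h * (ε * x₀ * Θ (ε * x₀)) + ρ (h * (ε * x₀ * Θ (ε * x₀)))) =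
      κ₂ * κ / κ₁ / (κ₂ * κ / κ₁ + ρ (κ₂ * κ / κ₁)) := by rw [hu']; exact newPoint_eq hρρ hρt ht0
  -- `1 + τ` is a doubly-fixed unit `≡ 1` to depth `r₀`, hence a `Θ`-norm of a `ρ`-fixed element
  have hρτ : ρ τ = τ := map_tau_eq hρρ hκ₁ hκ₂ hκtr
  have hΘτ : Θ τ = τ := mapTheta_tau_eq hΘρ hΘκ₁ hΘκ₂ hΘκ
  have hτr : Valued.v τ ≤ r₀ := by
    rw [hτdef, v_tau_eq hvρ, div_le_iff₀ (pow_pos hpos₁ 2)]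
    exact (mul_le_mul' le_rfl hdig).trans hrτ
  obtain ⟨c, hρc, hc⟩ := hdeep (1 + τ) (by rw [map_add, map_one, hρτ]) (by rw [map_add, map_one, hΘτ]) (by rw [add_sub_cancel_left]; exact hτr)
  have hc0 : c ≠ 0 := fun h0 => by
    rw [h0, zero_mul] at hc; rw [hTr, ← hc, map_zero] at hTr1; exact zero_ne_one hTr1
  -- assemble the membership of `ε • Λ`
  refine ⟨ε * x₀, mul_ne_zero hε0 hx₀, fun x => ?_, ?_, ?_, ?_, ?_, ?_, ?_⟩
  · rw [AddSubgroup.mem_smul_pointwise_iff_exists]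
    constructor
    · rintro ⟨s, hs, rfl⟩
      obtain ⟨z, hz, rfl⟩ := (hmem s).1 hs
      exact ⟨z, hz, by rw [smul_eq_mul, mul_assoc]⟩
    · rintro ⟨z, hz, rfl⟩
      exact ⟨x₀ * z, (hmem _).2 ⟨z, hz, rfl⟩, by rw [smul_eq_mul, mul_assoc]⟩
  · rw [hdg]; exact (isOrd_mul_iff_of_skew hvρ hN1 hsk _).2 hyO
  · rw [hdg, mul_div_assoc]
    intro h'
    rw [← mul_div_assoc] at h'
    exact hyprim ((isOrd_mul_div_iff_of_skew hvρ hN1 hsk hρϖ _).1 h')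
  · rw [hdg, Valuation.map_mul, hN1, one_mul, hylev]
  · rw [hdg]
    exact isOrd_div_mul_of_skew hvρ hN1 hsk hyO (by rw [hylev]; exact hμ) hdep
  · -- the class of `t′ = t·(1 + τ)`
    rw [ht', ← hcls]
    constructor
    · rintro ⟨c', hρc', hc'⟩
      refine ⟨c' / c, by rw [map_div₀, hρc', hρc], ?_⟩
      rw [map_div₀, div_mul_div_comm, hc', hc, mul_div_assoc, div_self (by rw [← hTr]; exact hTr0), mul_one]
    · rintro ⟨c', hρc', hc'⟩
      exact ⟨c' * c, by rw [map_mul, hρc', hρc], by rw [map_mul, ← hc', ← hc]; ring⟩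
  · -- the digit of the new vertex
    rw [hκ']
    exact hnew.trans hdig

/-- **HEAD′ — «FIBRES OVER TWO DIGITS OF ONE CLASS ARE EQUINUMEROUS» (equality).**  Same letters; the inverse flip `ε⁻¹` (`ε⁻¹Θε⁻¹ = ρκ₁∕ρκ₂`) injects the other way (the hypotheses
are symmetric: `|κ₂| = |κ₁|`), so `#fibre(P, κ₁) = #fibre(P, κ₂)`. [cite: Kottwitz1986BaseChangeUnits, §1 pp. 240–241] [cite: Flicker1998UnitaryFL, Prop. 7 p. 84] [cite: Jacobowitz1962, §4] -/
theorem ncard_fibre_eq_ncard_fibre (hρρ : ∀ x, ρ (ρ x) = x) (hvρ : ∀ x, Valued.v (ρ x) = Valued.v x) (hΘΘ : ∀ x, Θ (Θ x) = x)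
    (hΘρ : ∀ x, Θ (ρ x) = ρ (Θ x))
    {h ϖE μ : K} (hΘh : Θ h = h) (hρϖ : ρ ϖE = ϖE) (hϖ0 : ϖE ≠ 0) (hϖ1 : Valued.v ϖE ≤ 1) {j a : ℕ} (ha1 : 1 ≤ a)
    (hcc : ϖE ^ j * (α - ρ α) ≠ 0)
    (hμ : Valued.v μ ≤ (Valued.v ϖE ^ a) ^ 2)
    (hFgap : ∀ z : K, ρ z = z → Θ z = z → Valued.v ϖE < Valued.v z → Valued.v z ≤ 1 → Valued.v z = 1)
    {r₀ : ℤᵐ⁰} (hdeep : ∀ u : K, ρ u = u → Θ u = u → Valued.v (u - 1) ≤ r₀ → ∃ c : K, ρ c = c ∧ c * Θ c = u)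
    {κ₁ κ₂ : K} (hκ₁ : κ₁ + ρ κ₁ = 1) (hκ₂ : κ₂ + ρ κ₂ = 1) (hΘκ₁ : Θ κ₁ = κ₁) (hΘκ₂ : Θ κ₂ = κ₂)
    (hR : Valued.v κ₁ * Valued.v (ϖE ^ j * (α - ρ α)) = Valued.v ϖE ^ a) (h12 : Valued.v (κ₂ - κ₁) < Valued.v κ₁)
    {r : ℤᵐ⁰} (hr : r < Valued.v κ₁) (hrτ : Valued.v (κ₂ - κ₁) * r ≤ r₀ * Valued.v κ₁ ^ 2)
    {ε : K} (hε : ε * Θ ε = ρ κ₂ / ρ κ₁) (P : Prop) (hfin : (levelSet ρ Θ α ϖE h j a).Finite) :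
    {Λ : AddSubgroup K | ∃ x₀ : K, x₀ ≠ 0 ∧ (∀ x, x ∈ Λ ↔ ∃ ζ, IsOrd ρ α (ϖE ^ j) ζ ∧ x = x₀ * ζ) ∧
        IsOrd ρ α (ϖE ^ j) (dualGen ρ Θ α (ϖE ^ j) h x₀) ∧ ¬ IsOrd ρ α (ϖE ^ j) (dualGen ρ Θ α (ϖE ^ j) h x₀ / ϖE) ∧
        Valued.v (dualGen ρ Θ α (ϖE ^ j) h x₀) = Valued.v ϖE ^ a ∧ IsOrd ρ α (ϖE ^ j) (μ / dualGen ρ Θ α (ϖE ^ j) h x₀) ∧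
        ((∃ c : K, ρ c = c ∧ c * Θ c = h * (x₀ * Θ x₀) + ρ (h * (x₀ * Θ x₀))) ↔ P) ∧
        Valued.v (ρ (h * (x₀ * Θ x₀)) / (h * (x₀ * Θ x₀) + ρ (h * (x₀ * Θ x₀))) - κ₁) ≤ r}.ncard =
      {Λ : AddSubgroup K | ∃ x₀ : K, x₀ ≠ 0 ∧ (∀ x, x ∈ Λ ↔ ∃ ζ, IsOrd ρ α (ϖE ^ j) ζ ∧ x = x₀ * ζ) ∧
        IsOrd ρ α (ϖE ^ j) (dualGen ρ Θ α (ϖE ^ j) h x₀) ∧ ¬ IsOrd ρ α (ϖE ^ j) (dualGen ρ Θ α (ϖE ^ j) h x₀ / ϖE) ∧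
        Valued.v (dualGen ρ Θ α (ϖE ^ j) h x₀) = Valued.v ϖE ^ a ∧ IsOrd ρ α (ϖE ^ j) (μ / dualGen ρ Θ α (ϖE ^ j) h x₀) ∧
        ((∃ c : K, ρ c = c ∧ c * Θ c = h * (x₀ * Θ x₀) + ρ (h * (x₀ * Θ x₀))) ↔ P) ∧
        Valued.v (ρ (h * (x₀ * Θ x₀)) / (h * (x₀ * Θ x₀) + ρ (h * (x₀ * Θ x₀))) - κ₂) ≤ r}.ncard := by
  have h21v : Valued.v (κ₁ - κ₂) = Valued.v (κ₂ - κ₁) := by rw [← Valuation.map_neg, neg_sub]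
  have hκ₂v : Valued.v κ₂ = Valued.v κ₁ := v_eq_of_v_sub_lt h12
  have hκ₁0 : κ₁ ≠ 0 := fun h0 => by
    rw [h0, Valuation.map_zero, zero_mul] at hR
    exact pow_ne_zero _ ((Valuation.ne_zero_iff _).2 hϖ0) hR.symm
  refine le_antisymm
    (ncard_fibre_le_ncard_fibre hρρ hvρ hΘΘ hΘρ hΘh hρϖ hϖ0 hϖ1 ha1 hcc hμ hFgap hdeep hκ₁ hκ₂ hΘκ₁ hΘκ₂ hR h12 hr hrτ hε P hfin)
    (ncard_fibre_le_ncard_fibre hρρ hvρ hΘΘ hΘρ hΘh hρϖ hϖ0 hϖ1 ha1 hcc hμ hFgap hdeep hκ₂ hκ₁ hΘκ₂ hΘκ₁ (by rw [hκ₂v]; exact hR)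
      (by rw [h21v, hκ₂v]; exact h12) (by rw [hκ₂v]; exact hr) (by rw [h21v, hκ₂v]; exact hrτ) (ε := ε⁻¹) ?_ P hfin)
  rw [map_inv₀, ← mul_inv, hε, inv_div]

end Summit.HodgeConjecture.HodgeConjecture.Cruxes.H413.F0P3cDyRamRowCellFibreTransport

end
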